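import Mathlib.Algebra.Order.Field.Basic
import Mathlib.Algebra.Order.Field.Rat
import Mathlib.Algebra.Order.Ring.Basic
import Mathlib.Data.Rat.Cast.Order
import Mathlib.Data.Rat.Cast.CharZero
import Mathlib.Tactic.Ring
import Mathlib.Tactic.Linarith
import Mathlib.Tactic.Positivity
import Mathlib.Tactic.NormNum
import Mathlib.Data.Nat.ModEq

/-!
# Keyed sparse polynomials and certificate-sorted coefficient streams (kernel lane «K-STREAM»)

A kernel-cheap presentation of LARGE exact polynomial identities (the identity side of Gram-form
SOS / Positivstellensatz certificates with tens of thousands of monomials), complementary to the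
list-carrier lanes `SumOfSquares` / `GramSOS` / `GramSOSList` of this directory:

* **Keyed monomials.** A monomial in the variables `x 0, …, x (n-1)` is ONE natural number, its
  Kronecker code in base `b`: digit `i` is the exponent of `x i` (`monoEval`). Products are key
  ADDITIONS as long as no digit carries, which is guaranteed by digit bounds checked once per input
  key (`digitsLe`, `monoEval_add`) — never per product.
* **Sorted group sums.** A certificate that wants the kernel to agree that a long list of
  contributions `Σ_e c_e · x^{κ_e}` equals a target polynomial `Σ_t p_t · x^{κ_t}` SORTS its
  contributions by key; the kernel walks the list ONCE, checks that keys do not decrease, sums each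
  group of equal keys and compares with the target's coefficient (`groupCheck`,
  `eval_eq_of_groupCheck`). No merging or sorting happens inside the kernel and no partial sum is
  ever written as a literal.
* **Splitting.** Soundness needs no window bookkeeping: a long identity is cut by the certificate
  into consecutive slices (contributions AND target cut at the same keys), each slice is ONE
  `groupCheck` in its own file, and the slice equalities simply add up (`ZTerms.eval_append`).
* **No `Int` arithmetic in the kernel.** Coefficients travel as (sign, magnitude) pairs and group
  sums as differences of naturals (`STerms`, `walk`); large negative `Int` values are slow in the
  kernel (certnum kernel cost law #2, 2026-08-27), naturals are GMP-backed.

The instances (Gram entry streams tied to a row-major PSD twin by a position table; product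
contribution streams over packed coefficient tables) live in the companion files; this file is the
generic core. Semantics are over any commutative (semi)ring / field; the checkers are `Bool`
functions meant for `decide +kernel` on numeral data (all arithmetic in `ℕ`/`ℤ`).

References: Kronecker substitution / codes for monomials [folklore; cf. the base-`M` codes of
`Literature.Algebra.Polynomial.CasasAlvero.CertCheck.monoEval`, same recursion, kept local to avoid
a `Certificates → CasasAlvero` import]; Gram-form SOS certificates [cite: BlekhermanParriloThomas2012,
Thm 3.39 / Thm 3.127]; rational SOS certificates and their exact verification [cite:
PeyrlParrilo2008, §3].

WHAT THIS FILE IS NOT: not a decision procedure (it checks a supplied, pre-sorted certificate);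
no completeness claim; no `MvPolynomial` bridge (as for `SOS.Poly`, the bridge to a concrete goal is
`simp` + `ring` on `monoEval` / `ZTerms.eval` for SMALL polynomials — large ones are only ever
compared key-wise by the kernel).
-/

namespace Literature.Computation.Certificates

namespace SOS

namespace Keyed

/-! ### Keyed monomials -/

section Mono

variable {R : Type*} [CommSemiring R]

/-- **Value of the monomial coded by `k`** (base-`b` Kronecker code, `n` digits, variables from
index `i` on): `monoEval x b n i k = (x i)^{k % b} · (x (i+1))^{(k / b) % b} · ⋯` (`n` factors).
Digits beyond the `n`-th are ignored (Kronecker substitution read backwards). [cite: Harvey2009, §3.1] -/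
def monoEval (x : ℕ → R) (b : ℕ) : ℕ → ℕ → ℕ → R
  | 0, _, _ => 1
  | n + 1, i, k => x i ^ (k % b) * monoEval x b n (i + 1) (k / b)

/-- No digits: the empty monomial `1`. [cite: Harvey2009, §3.1] -/
@[simp] theorem monoEval_zero_digits (x : ℕ → R) (b i k : ℕ) : monoEval x b 0 i k = 1 := rfl

/-- Peel the lowest digit. [cite: Harvey2009, §3.1] -/
@[simp] theorem monoEval_succ (x : ℕ → R) (b n i k : ℕ) :
    monoEval x b (n + 1) i k = x i ^ (k % b) * monoEval x b n (i + 1) (k / b) := rfl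

/-- The code `0` is the monomial `1`. [cite: Harvey2009, §3.1] -/
theorem monoEval_key_zero (x : ℕ → R) (b : ℕ) : ∀ n i, monoEval x b n i 0 = 1
  | 0, _ => rfl
  | n + 1, i => by simp [monoEval_key_zero x b n]

/-- **Digit bound**: the `n` base-`b` digits of `k` are all `≤ D` AND `k` has no digit beyond the
`n`-th (`k < b^n`), so that codes are canonical. Checked once per input key. [cite: Harvey2009, §3.1] -/
def digitsLe (b D : ℕ) : ℕ → ℕ → Bool
  | 0, k => k == 0
  | n + 1, k => decide (k % b ≤ D) && digitsLe b D n (k / b)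

/-- `digitsLe` at `n + 1` digits, unfolded. [cite: Harvey2009, §3.1] -/
@[simp] theorem digitsLe_succ (b D n k : ℕ) :
    digitsLe b D (n + 1) k = (decide (k % b ≤ D) && digitsLe b D n (k / b)) := rfl

/-- `digitsLe` at `0` digits, unfolded. [cite: Harvey2009, §3.1] -/
@[simp] theorem digitsLe_zero (b D k : ℕ) : digitsLe b D 0 k = (k == 0) := rfl

/-- A key passing `digitsLe b D n` is `< b ^ n`. [cite: Harvey2009, §3.1] -/
theorem lt_pow_of_digitsLe {b D : ℕ} (hb : 0 < b) :
    ∀ {n k : ℕ}, digitsLe b D n k = true → k < b ^ n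
  | 0, k, h => by simp at h; simp [h]
  | n + 1, k, h => by
    simp only [digitsLe_succ, Bool.and_eq_true, decide_eq_true_eq] at h
    have ih := lt_pow_of_digitsLe hb h.2
    calc k = k % b + b * (k / b) := (Nat.mod_add_div k b).symm
      _ < b + b * (k / b) := by have := Nat.mod_lt k hb; omega
      _ = b * (k / b + 1) := by ring
      _ ≤ b * b ^ n := Nat.mul_le_mul_left b ih
      _ = b ^ (n + 1) := by ring

/-- **Products of monomials are sums of codes** when no digit can carry: digit bounds `D₁`, `D₂`
with `D₁ + D₂ < b` (the no-overlap condition of Kronecker substitution). [cite: Harvey2009, §3.1] -/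
theorem monoEval_add (x : ℕ → R) {b D₁ D₂ : ℕ} (hD : D₁ + D₂ < b) :
    ∀ (n i k₁ k₂ : ℕ), digitsLe b D₁ n k₁ = true → digitsLe b D₂ n k₂ = true →
      monoEval x b n i (k₁ + k₂) = monoEval x b n i k₁ * monoEval x b n i k₂
  | 0, _, _, _, _, _ => by simp
  | n + 1, i, k₁, k₂, h₁, h₂ => by
    simp only [digitsLe_succ, Bool.and_eq_true, decide_eq_true_eq] at h₁ h₂
    have hlt : k₁ % b + k₂ % b < b := by omega
    rw [monoEval_succ, monoEval_succ, monoEval_succ, Nat.add_mod_of_add_mod_lt hlt,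
      Nat.add_div_eq_of_add_mod_lt hlt, monoEval_add x hD n (i + 1) _ _ h₁.2 h₂.2, pow_add]
    ring

/-- Digit bounds add under carry-free addition (for products of three and more factors).
[cite: Harvey2009, §3.1] -/
theorem digitsLe_add {b D₁ D₂ : ℕ} (hD : D₁ + D₂ < b) :
    ∀ (n k₁ k₂ : ℕ), digitsLe b D₁ n k₁ = true → digitsLe b D₂ n k₂ = true →
      digitsLe b (D₁ + D₂) n (k₁ + k₂) = true
  | 0, k₁, k₂, h₁, h₂ => by simp at h₁ h₂ ⊢; omega
  | n + 1, k₁, k₂, h₁, h₂ => by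
    simp only [digitsLe_succ, Bool.and_eq_true, decide_eq_true_eq] at h₁ h₂ ⊢
    have hlt : k₁ % b + k₂ % b < b := by omega
    rw [Nat.add_mod_of_add_mod_lt hlt, Nat.add_div_eq_of_add_mod_lt hlt]
    exact ⟨by omega, digitsLe_add hD n _ _ h₁.2 h₂.2⟩

/-- A digit bound may be weakened. [cite: Harvey2009, §3.1] -/
theorem digitsLe_mono {b D D' : ℕ} (hDD : D ≤ D') :
    ∀ (n k : ℕ), digitsLe b D n k = true → digitsLe b D' n k = true
  | 0, k, h => by simpa using h
  | n + 1, k, h => by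
    simp only [digitsLe_succ, Bool.and_eq_true, decide_eq_true_eq] at h ⊢
    exact ⟨le_trans h.1 hDD, digitsLe_mono hDD n _ h.2⟩

end Mono

/-! ### Integer-coefficient term lists (semantics) -/

/-- An **integer term list** `[(κ₀, c₀), (κ₁, c₁), …]` (keys with integer coefficients): the common
currency of contribution streams and scaled targets. [cite: BlekhermanParriloThomas2012, §3.1.4 eq. (3.12), p. 64] -/
abbrev ZTerms := List (ℕ × ℤ)

namespace ZTerms

section Field

variable {R : Type*} [Field R]

/-- Value `Σ cₜ · x^{κₜ}`. [cite: BlekhermanParriloThomas2012, §3.1.4 eq. (3.12), p. 64] -/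
def eval (x : ℕ → R) (b n : ℕ) : ZTerms → R
  | [] => 0
  | (k, c) :: p => (c : R) * monoEval x b n 0 k + eval x b n p

/-- `eval` of the empty list. [cite: BlekhermanParriloThomas2012, §3.1.4 eq. (3.12), p. 64] -/
@[simp] theorem eval_nil (x : ℕ → R) (b n : ℕ) : eval x b n ([] : ZTerms) = 0 := rfl

/-- `eval` of a cons. [cite: BlekhermanParriloThomas2012, §3.1.4 eq. (3.12), p. 64] -/
@[simp] theorem eval_cons (x : ℕ → R) (b n k : ℕ) (c : ℤ) (p : ZTerms) :
    eval x b n ((k, c) :: p) = (c : R) * monoEval x b n 0 k + eval x b n p := rfl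

/-- `eval` is additive over concatenation (how consecutive slices of one identity add up). [cite: BlekhermanParriloThomas2012, §3.1.4 eq. (3.12), p. 64] -/
theorem eval_append (x : ℕ → R) (b n : ℕ) :
    ∀ p q : ZTerms, eval x b n (p ++ q) = eval x b n p + eval x b n q
  | [], q => by simp
  | (k, c) :: p, q => by rw [List.cons_append, eval_cons, eval_cons, eval_append x b n p q]; ring

end Field

end ZTerms

/-! ### Sign–magnitude term lists (the kernel's currency) -/

/-- Integer value of a (sign, magnitude) pair: `true` = nonnegative. Kept out of `Int` arithmetic
on purpose (large negative `Int`s are slow in the kernel; all checks below compute in `ℕ`).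
[cite: BlekhermanParriloThomas2012, §3.1.4 eq. (3.12), p. 64] -/
def sval (sg : Bool) (m : ℕ) : ℤ := if sg then (m : ℤ) else -(m : ℤ)

/-- A **sign–magnitude term list** `[(κ, sg, m), …]` = the integer term list `[(κ, ±m), …]`.
[cite: BlekhermanParriloThomas2012, §3.1.4 eq. (3.12), p. 64] -/
abbrev STerms := List (ℕ × Bool × ℕ)

namespace STerms

/-- The integer term list denoted by a sign–magnitude term list. [cite: BlekhermanParriloThomas2012, §3.1.4 eq. (3.12), p. 64] -/
def toZ : STerms → ZTerms
  | [] => []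
  | (k, sg, m) :: p => (k, sval sg m) :: toZ p

/-- `toZ` of the empty list. [cite: BlekhermanParriloThomas2012, §3.1.4 eq. (3.12), p. 64] -/
@[simp] theorem toZ_nil : toZ ([] : STerms) = [] := rfl

/-- `toZ` of a cons. [cite: BlekhermanParriloThomas2012, §3.1.4 eq. (3.12), p. 64] -/
@[simp] theorem toZ_cons (k : ℕ) (sg : Bool) (m : ℕ) (p : STerms) :
    toZ ((k, sg, m) :: p) = (k, sval sg m) :: toZ p := rfl

/-- All magnitudes vanish. [cite: BlekhermanParriloThomas2012, §3.1.4 eq. (3.12), p. 64] -/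
def allZero (p : STerms) : Bool := p.all fun t => t.2.2 == 0

section Field

variable {R : Type*} [Field R]

/-- An all-zero term list evaluates to `0`. [cite: BlekhermanParriloThomas2012, §3.1.4 eq. (3.12), p. 64] -/
theorem eval_eq_zero_of_allZero (x : ℕ → R) (b n : ℕ) :
    ∀ p : STerms, allZero p = true → ZTerms.eval x b n (toZ p) = 0
  | [], _ => rfl
  | (k, sg, m) :: p, h => by
    simp only [allZero, List.all_cons, Bool.and_eq_true, beq_iff_eq] at h
    rw [toZ_cons, ZTerms.eval_cons, eval_eq_zero_of_allZero x b n p (by simpa [allZero] using h.2),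
      h.1]
    simp [sval]

end Field

end STerms

/-! ### The sorted group-sum walk (all arithmetic in `ℕ`) -/

/-- Pop the target's coefficient at key `κ`: skip target terms with SMALLER keys, which must carry
magnitude `0`; return the (sign, magnitude) found at `κ` (`0` if the next key is larger or the
target is exhausted) and the remaining target. `none` = a skipped term was nonzero. Meant for
targets sorted by key, but its specification `eval_popTarget` holds unconditionally. [cite: BlekhermanParriloThomas2012, §3.1.4 eq. (3.12), p. 64] -/
def popTarget (κ : ℕ) : STerms → Option ((Bool × ℕ) × STerms)
  | [] => some ((true, 0), [])
  | (k, sg, m) :: rest =>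
    if k < κ then (if m = 0 then popTarget κ rest else none)
    else if k = κ then some ((sg, m), rest)
    else some ((true, 0), (k, sg, m) :: rest)

/-- `P − N = ± m` as a test on naturals. [cite: BlekhermanParriloThomas2012, §3.1.4 eq. (3.12), p. 64] -/
def matchAcc (P N : ℕ) (sg : Bool) (m : ℕ) : Bool :=
  if sg then P == N + m else P + m == N

/-- **The walk** (fuel = number of contributions + 1). State: the current group key `κ` and its
running sum as a difference `P − N` of naturals; contributions `E` (keys non-decreasing — checked),
target `T`. At each key change the finished group is compared with the target's coefficient at
`κ`; at the end the last group is compared and the rest of the target must vanish — the coefficient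
matching `p_α = Σ_{β+γ=α} Q_{βγ}` of the Gram method, organised as ONE pass over pre-sorted data.
[cite: BlekhermanParriloThomas2012, §3.1.4 eq. (3.12), p. 64] -/
def walk : ℕ → ℕ → ℕ → ℕ → STerms → STerms → Bool
  | 0, _, _, _, _, _ => false
  | _ + 1, κ, P, N, [], T =>
    match popTarget κ T with
    | none => false
    | some ((sg, m), T') => matchAcc P N sg m && STerms.allZero T'
  | fuel + 1, κ, P, N, (k, sg, m) :: E, T =>
    if k = κ then (if sg then walk fuel κ (P + m) N E T else walk fuel κ P (N + m) E T)
    else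
      decide (κ < k) &&
        (match popTarget κ T with
         | none => false
         | some ((sg₀, m₀), T') =>
           matchAcc P N sg₀ m₀ && (if sg then walk fuel k m 0 E T' else walk fuel k 0 m E T'))

/-- **Group check**: the contributions `E` (sorted by key by the certificate) have, key by key, the
group sums recorded in the target `T` (sorted by key), and `T` has nothing else. One pass, no
merging or sorting inside the kernel, no `Int` arithmetic. [cite: BlekhermanParriloThomas2012, §3.1.4 eq. (3.12), p. 64] -/
def groupCheck (E T : STerms) : Bool :=
  match E with
  | [] => STerms.allZero T
  | (k, sg, m) :: E' =>
    if sg then walk (E'.length + 1) k m 0 E' T else walk (E'.length + 1) k 0 m E' T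

section Sound

variable {R : Type*} [Field R]

open ZTerms STerms

/-- The value of `sval` as a field element. [cite: BlekhermanParriloThomas2012, §3.1.4 eq. (3.12), p. 64] -/
theorem cast_sval (sg : Bool) (m : ℕ) : ((sval sg m : ℤ) : R) = if sg then (m : R) else -(m : R) := by
  unfold sval; split <;> push_cast <;> rfl

/-- Specification of `matchAcc`. [cite: BlekhermanParriloThomas2012, §3.1.4 eq. (3.12), p. 64] -/
theorem matchAcc_spec {P N : ℕ} {sg : Bool} {m : ℕ} (h : matchAcc P N sg m = true) :
    (P : R) - N = ((sval sg m : ℤ) : R) := by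
  unfold matchAcc at h
  rw [cast_sval]
  cases sg with
  | true =>
    simp only [if_true, beq_iff_eq] at h ⊢
    rw [h]; push_cast; ring
  | false =>
    simp only [Bool.false_eq_true, if_false, beq_iff_eq] at h ⊢
    rw [← h]; push_cast; ring

/-- Specification of `popTarget`: the popped coefficient accounts for the target down to the
returned remainder. [cite: BlekhermanParriloThomas2012, §3.1.4 eq. (3.12), p. 64] -/
theorem eval_popTarget (x : ℕ → R) (b n κ : ℕ) :
    ∀ (T : STerms) {c : Bool × ℕ} {T' : STerms}, popTarget κ T = some (c, T') →
      eval x b n (toZ T) = ((sval c.1 c.2 : ℤ) : R) * monoEval x b n 0 κ + eval x b n (toZ T')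
  | [], c, T', h => by
    simp only [popTarget, Option.some.injEq, Prod.mk.injEq] at h
    obtain ⟨rfl, rfl⟩ := h; simp [sval]
  | (k, sg, m) :: rest, c, T', h => by
    unfold popTarget at h
    by_cases hlt : k < κ
    · rw [if_pos hlt] at h
      by_cases hc : m = 0
      · rw [if_pos hc] at h
        rw [toZ_cons, eval_cons, hc, eval_popTarget x b n κ rest h]; simp [sval]
      · rw [if_neg hc] at h; exact absurd h (by simp)
    · rw [if_neg hlt] at h
      by_cases heq : k = κ
      · rw [if_pos heq] at h
        simp only [Option.some.injEq, Prod.mk.injEq] at h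
        obtain ⟨rfl, rfl⟩ := h
        rw [toZ_cons, eval_cons, heq]
      · rw [if_neg heq] at h
        simp only [Option.some.injEq, Prod.mk.injEq] at h
        obtain ⟨rfl, rfl⟩ := h
        simp [sval]

/-- **Invariant of the walk**: acceptance means `(P − N) · x^κ + Σ E = Σ T`. [cite: BlekhermanParriloThomas2012, §3.1.4 eq. (3.12), p. 64] -/
theorem eval_walk (x : ℕ → R) (b n : ℕ) :
    ∀ (fuel κ P N : ℕ) (E T : STerms), walk fuel κ P N E T = true →
      ((P : R) - N) * monoEval x b n 0 κ + eval x b n (toZ E) = eval x b n (toZ T)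
  | 0, _, _, _, _, _, h => by simp [walk] at h
  | fuel + 1, κ, P, N, [], T, h => by
    unfold walk at h
    cases hp : popTarget κ T with
    | none => rw [hp] at h; exact absurd h (by simp)
    | some cT =>
      obtain ⟨⟨sg, m⟩, T'⟩ := cT
      rw [hp] at h
      simp only [Bool.and_eq_true] at h
      rw [eval_popTarget x b n κ T hp, toZ_nil, eval_nil, eval_eq_zero_of_allZero x b n T' h.2,
        matchAcc_spec h.1, add_zero]
  | fuel + 1, κ, P, N, (k, sg, m) :: E, T, h => by
    unfold walk at h
    by_cases hk : k = κ
    · rw [if_pos hk] at h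
      rw [toZ_cons, eval_cons, cast_sval, hk]
      cases sg with
      | true =>
        simp only [if_true] at h ⊢
        rw [← eval_walk x b n fuel κ (P + m) N E T h]; push_cast; ring
      | false =>
        simp only [Bool.false_eq_true, if_false] at h ⊢
        rw [← eval_walk x b n fuel κ P (N + m) E T h]; push_cast; ring
    · rw [if_neg hk] at h
      simp only [Bool.and_eq_true, decide_eq_true_eq] at h
      obtain ⟨_, h⟩ := h
      cases hp : popTarget κ T with
      | none => rw [hp] at h; exact absurd h (by simp)
      | some cT =>
        obtain ⟨⟨sg₀, m₀⟩, T'⟩ := cT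
        rw [hp] at h
        simp only [Bool.and_eq_true] at h
        rw [eval_popTarget x b n κ T hp, toZ_cons, eval_cons, ← matchAcc_spec h.1, cast_sval]
        cases sg with
        | true =>
          simp only [if_true] at h ⊢
          rw [← eval_walk x b n fuel k m 0 E T' h.2]; push_cast; ring
        | false =>
          simp only [Bool.false_eq_true, if_false] at h ⊢
          rw [← eval_walk x b n fuel k 0 m E T' h.2]; push_cast; ring

/-- **Soundness of the group check**: the contributions and the target are the same polynomial
(as functions on any field): the kernel form of coefficient matching. [cite: BlekhermanParriloThomas2012, §3.1.4 eq. (3.12), p. 64] -/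
theorem eval_eq_of_groupCheck (x : ℕ → R) (b n : ℕ) {E T : STerms} (h : groupCheck E T = true) :
    eval x b n (toZ E) = eval x b n (toZ T) := by
  unfold groupCheck at h
  cases E with
  | nil => rw [toZ_nil, eval_nil, eval_eq_zero_of_allZero x b n T h]
  | cons t E' =>
    obtain ⟨k, sg, m⟩ := t
    rw [toZ_cons, eval_cons, cast_sval]
    cases sg with
    | true =>
      simp only [if_true] at h ⊢
      rw [← eval_walk x b n _ k m 0 E' T h]; push_cast; ring
    | false =>
      simp only [Bool.false_eq_true, if_false] at h ⊢
      rw [← eval_walk x b n _ k 0 m E' T h]; push_cast; ring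

end Sound

/-! ### Tests (kernel) -/

section Tests

/-- `x₀² · x₁` times `x₁ · x₂³` in base 16 on 3 variables: codes add. -/
example : digitsLe 16 7 3 (2 + 1 * 16) = true ∧ digitsLe 16 7 3 (1 * 16 + 3 * 256) = true := by decide

/-- Two groups (keys 5: 2 − 3 = −1, and 9: 4 + 4 = 8) against a target with an explicit zero at key 7. -/
example : groupCheck [(5, true, 2), (5, false, 3), (9, true, 4), (9, true, 4)]
    [(5, false, 1), (7, true, 0), (9, true, 8)] = true := by decide

/-- A wrong group sum is refused. -/
example : groupCheck [(5, true, 2), (5, false, 3), (9, true, 4)] [(5, false, 1), (9, true, 8)] = false := by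
  decide

/-- A target term matched by no group is refused unless it is zero. -/
example : groupCheck [(5, true, 2)] [(5, true, 2), (9, true, 1)] = false := by decide

/-- Unsorted contributions are refused. -/
example : groupCheck [(9, true, 2), (5, true, 2)] [(5, true, 2), (9, true, 2)] = false := by decide

end Tests

end Keyed

end SOS

end Literature.Computation.Certificates
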